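import Literature.MathematicalPhysics.KineticTheory.HardSphereBBGKYRegularity
import Literature.MathematicalPhysics.KineticTheory.HardSphereBBGKYLiouvilleEstimate
import HarnessLib

/-!
# The flux form of the outgoing collision operator
(Bodineau–Gallagher–Saint-Raymond 2016 §3.1 (3.3)–(3.5), p. 9; Cercignani–Illner–Pulvirenti 1994
§4.3 (3.5)–(3.7), App. 4.B; trunk T-KINETIC, topic MathematicalPhysics/KineticTheory; step T5 of
the plan for the input (S) — the iterated Duhamel formula almost everywhere — of
`bodineau_gallagher_saintRaymond_linear_of_S`.)

In the derivation of the BBGKY hierarchy from the Liouville dynamics (CIP 1994 Thm 4.3.1), the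
change of a test function `ψ` of the `s` tagged particles across a tagged–untagged collision,
integrated against the flux through the contact sphere, is
`∫ dY ∫ dσ(ω) dv (ω·(v - v_i))₊ [ψ(Y) - ψ(Y')] P(Y, x_i + εω, v)` where `(Y, x_i + εω, v)` is the
OUTGOING contact configuration (tagged particle `i` with its outgoing velocity `v_i`, partner at
`x_i + εω` with outgoing velocity `v`) and `Y'` is `Y` with the INCOMING velocity `v_i'` of
particle `i`. This file PROVES that this flux form equals the pairing of `ψ` with the outgoing
collision term of `P` (`hsCollisionTerm … (P ∘ outRep)`, the collision operator of
`HardSphereHierarchyModel`): the `ψ(Y)`-part is the gain term read at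
`outRep (gainConfig Y i ω v) = lossConfig Y i ω v`, and the `ψ(Y')`-part becomes, after the
measure-preserving scattering of the parameters `(Y, v) ↦ (Y', v')`
(`measurePreserving_scatterSkew`), the loss term read at `outRep (lossConfig Y' i ω v') =
gainConfig Y' i ω v'` (`flux_bracket_eq_integral_mul_hsCollisionTerm`).

## References

* T. Bodineau, I. Gallagher, L. Saint-Raymond, Invent. Math. 203 (2016), arXiv:1305.3397v2,
  §3.1 (3.3)–(3.5), p. 9 (collision operator, boundary condition, pre- and post-collisional reads).
* C. Cercignani, R. Illner, M. Pulvirenti, *The Mathematical Theory of Dilute Gases*, Springer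
  (1994), §4.3 (3.5)–(3.7) and App. 4.B.
-/

open MeasureTheory Metric Real Set Filter Function
open scoped Nat InnerProductSpace ENNReal
open Literature.Analysis.FluidPDE (Config configEnergy Geometry hardSphereDomain collidePair hsCollisionTerm
  lossConfig gainConfig appendParticle reflectVel)
open Literature.Analysis.FluidPDE

namespace Literature.MathematicalPhysics.KineticTheory

noncomputable section

section Kinetic

variable {d : Type*} [Fintype d]

/-! ## §1. The scattering of the parameters is an involution -/

section Involution

variable {X : Type*} {m : ℕ} (i : Fin (m + 1)) (ω : sphere (0 : EuclideanSpace ℝ d) 1)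

/-- The scattering of the parameters is an involution. [folklore] -/
theorem scatterParams_scatterParams (p : Config (m + 1) d X × EuclideanSpace ℝ d) :
    scatterParams i ω (scatterParams i ω p) = p := by
  obtain ⟨Z, v⟩ := p
  have hc : collide ω (((scatterParams i ω (Z, v)).1 i).2, (scatterParams i ω (Z, v)).2) = ((Z i).2, v) := by
    simp only [scatterParams, Function.update_self]
    exact collide_collide ω ((Z i).2, v)
  refine Prod.ext ?_ ?_
  · funext j
    by_cases hj : j = i
    · subst hj
      simp only [scatterParams, Function.update_self] at hc ⊢
      exact Prod.ext rfl (congrArg Prod.fst hc)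
    · simp [scatterParams, Function.update_of_ne hj]
  · simp only [scatterParams, Function.update_self] at hc ⊢
    exact congrArg Prod.snd hc

/-- The simultaneous scattering at the impact direction read from the point is an involution.
[folklore] -/
theorem scatterSkew_scatterSkew (x : Config (m + 1) d X × (sphere (0 : EuclideanSpace ℝ d) 1 × EuclideanSpace ℝ d)) :
    (fun x : Config (m + 1) d X × (sphere (0 : EuclideanSpace ℝ d) 1 × EuclideanSpace ℝ d) =>
        ((scatterParams i x.2.1 (x.1, x.2.2)).1, (x.2.1, (scatterParams i x.2.1 (x.1, x.2.2)).2)))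
      (((scatterParams i x.2.1 (x.1, x.2.2)).1, (x.2.1, (scatterParams i x.2.1 (x.1, x.2.2)).2))) = x := by
  obtain ⟨Z, ω', v⟩ := x
  have h := scatterParams_scatterParams i ω' (Z, v)
  simp only at h ⊢
  rw [show ((scatterParams i ω' (Z, v)).1, (scatterParams i ω' (Z, v)).2) = scatterParams i ω' (Z, v) from rfl, h]

end Involution

/-! ## §2. The flux form of the outgoing collision term -/

section Flux

variable {ε : ℝ} (hε : 0 < ε) (hε' : ε < 2⁻¹)

include hε hε'

/-- **The flux form of the outgoing collision operator.** For a measurable `P` on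
`(k+1)`-configurations with a Gaussian bound and a bounded measurable `ψ` on `k`-configurations,
`∫ dY ∫ (ω·(v - v_i))₊ [ψ(Y) - ψ(Y')] P(lossConfig Y i ω v) dσ(ω) dv = ∫ ψ(Y) (C^{i,out} P)(Y) dY`
where `Y' = (scatterParams i ω (Y, v)).1` carries the incoming velocity of particle `i` and
`C^{i,out} P = hsCollisionTerm … i (P ∘ outRep … i)` is the `i`-th outgoing collision term
(gain read at `outRep ∘ gainConfig = lossConfig`, loss read at `outRep ∘ lossConfig = gainConfig`
after the measure-preserving scattering `measurePreserving_scatterSkew`). [cite: BodineauGallagherSaintRaymondInvent2016, §3.1 (3.3)-(3.5), p. 9] -/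
theorem flux_bracket_eq_integral_mul_hsCollisionTerm {m : ℕ} (i : Fin (m + 1))
    {P : Config (m + 1 + 1) d (UnitAddTorus d) → ℝ} (hPm : Measurable P) {K β : ℝ} (hK : 0 ≤ K) (hβ : 0 < β)
    (hP : ∀ W, |P W| ≤ K * Real.exp (-β * configEnergy W))
    {ψ : Config (m + 1) d (UnitAddTorus d) → ℝ} (hψm : Measurable ψ) {Cψ : ℝ} (hψ : ∀ Y, |ψ Y| ≤ Cψ) :
    ∫ Y : Config (m + 1) d (UnitAddTorus d),
        ∫ q : sphere (0 : EuclideanSpace ℝ d) 1 × EuclideanSpace ℝ d,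
          max ⟪(q.1 : EuclideanSpace ℝ d), q.2 - (Y i).2⟫_ℝ 0 *
            (ψ Y - ψ (scatterParams i q.1 (Y, q.2)).1) * P (lossConfig (Torus.geometry d) ε Y i q.1 q.2)
          ∂((sphereMeasure (E := EuclideanSpace ℝ d)).prod volume) =
      ∫ Y : Config (m + 1) d (UnitAddTorus d),
        ψ Y * hsCollisionTerm (Torus.geometry d) ε (m + 1) i (P ∘ outRep (Torus.geometry d) (m + 1) i) Y := by
  classical
  haveI hσf : IsFiniteMeasure (sphereMeasure (E := EuclideanSpace ℝ d)) :=
    Literature.Analysis.FluidPDE.isFiniteMeasure_sphereMeasure (E := EuclideanSpace ℝ d)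
  haveI hσs : SigmaFinite (sphereMeasure (E := EuclideanSpace ℝ d)) := @IsFiniteMeasure.toSigmaFinite _ _ _ hσf
  haveI hXE : SigmaFinite (volume : Measure (UnitAddTorus d × EuclideanSpace ℝ d)) := inferInstance
  haveI hC : SigmaFinite (volume : Measure (Config (m + 1) d (UnitAddTorus d))) := inferInstance
  set G := Torus.geometry d with hG
  set κ : Measure (sphere (0 : EuclideanSpace ℝ d) 1 × EuclideanSpace ℝ d) :=
    (sphereMeasure (E := EuclideanSpace ℝ d)).prod volume with hκ
  haveI hκs : SigmaFinite κ := by rw [hκ]; infer_instance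
  have hGm := Torus.isMeasurable_geometry (d := d)
  have hCψ : 0 ≤ Cψ := (abs_nonneg _).trans (hψ (fun _ => ((0 : UnitAddTorus d), (0 : EuclideanSpace ℝ d))))
  -- the two integrands on the product `Config × (S × E)` and their common dominating function
  set a : Config (m + 1) d (UnitAddTorus d) × (sphere (0 : EuclideanSpace ℝ d) 1 × EuclideanSpace ℝ d) → ℝ :=
    fun x => max ⟪(x.2.1 : EuclideanSpace ℝ d), x.2.2 - (x.1 i).2⟫_ℝ 0 * ψ x.1 * P (lossConfig G ε x.1 i x.2.1 x.2.2) with ha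
  set b : Config (m + 1) d (UnitAddTorus d) × (sphere (0 : EuclideanSpace ℝ d) 1 × EuclideanSpace ℝ d) → ℝ :=
    fun x => max ⟪(x.2.1 : EuclideanSpace ℝ d), x.2.2 - (x.1 i).2⟫_ℝ 0 * ψ (scatterParams i x.2.1 (x.1, x.2.2)).1 *
      P (lossConfig G ε x.1 i x.2.1 x.2.2) with hb
  set c : Config (m + 1) d (UnitAddTorus d) × (sphere (0 : EuclideanSpace ℝ d) 1 × EuclideanSpace ℝ d) → ℝ :=
    fun x => max (-⟪(x.2.1 : EuclideanSpace ℝ d), x.2.2 - (x.1 i).2⟫_ℝ) 0 * ψ x.1 * P (gainConfig G ε x.1 i x.2.1 x.2.2) with hc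
  set D : Config (m + 1) d (UnitAddTorus d) × (sphere (0 : EuclideanSpace ℝ d) 1 × EuclideanSpace ℝ d) → ℝ :=
    fun x => ((Cψ + 1) * K * (1 + ‖(x.1 i).2‖) * Real.exp (-β * configEnergy x.1)) *
      ((1 + ‖x.2.2‖) * Real.exp (-(β / 2) * ‖x.2.2‖ ^ 2)) with hD
  -- measurability
  have hY : Measurable fun x : Config (m + 1) d (UnitAddTorus d) × (sphere (0 : EuclideanSpace ℝ d) 1 × EuclideanSpace ℝ d) => x.1 :=
    measurable_fst
  have hω : Measurable fun x : Config (m + 1) d (UnitAddTorus d) × (sphere (0 : EuclideanSpace ℝ d) 1 × EuclideanSpace ℝ d) =>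
      (x.2.1 : EuclideanSpace ℝ d) := measurable_subtype_coe.comp measurable_snd.fst
  have hv : Measurable fun x : Config (m + 1) d (UnitAddTorus d) × (sphere (0 : EuclideanSpace ℝ d) 1 × EuclideanSpace ℝ d) =>
      x.2.2 := measurable_snd.snd
  have hvi : Measurable fun x : Config (m + 1) d (UnitAddTorus d) × (sphere (0 : EuclideanSpace ℝ d) 1 × EuclideanSpace ℝ d) =>
      (x.1 i).2 := ((measurable_pi_apply i).comp hY).snd
  have hflux : Measurable fun x : Config (m + 1) d (UnitAddTorus d) × (sphere (0 : EuclideanSpace ℝ d) 1 × EuclideanSpace ℝ d) =>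
      ⟪(x.2.1 : EuclideanSpace ℝ d), x.2.2 - (x.1 i).2⟫_ℝ := hω.inner (hv.sub hvi)
  have hloss := measurable_lossConfig hGm.measurable_translate ε i hY hω hv
  have hgain := measurable_gainConfig hGm.measurable_translate ε i hY hω hv
  have hΞ := measurePreserving_scatterSkew (d := d) i
  have ham : Measurable a := ((hflux.max measurable_const).mul (hψm.comp hY)).mul (hPm.comp hloss)
  have hbm : Measurable b :=
    ((hflux.max measurable_const).mul (hψm.comp (hΞ.measurable.fst))).mul (hPm.comp hloss)
  have hcm : Measurable c := ((hflux.neg.max measurable_const).mul (hψm.comp hY)).mul (hPm.comp hgain)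
  -- the dominating function is integrable
  have hDi : Integrable D ((volume : Measure (Config (m + 1) d (UnitAddTorus d))).prod κ) := by
    have h1 : Integrable (fun Y : Config (m + 1) d (UnitAddTorus d) =>
        (Cψ + 1) * K * (1 + ‖(Y i).2‖) * Real.exp (-β * configEnergy Y)) := by
      have hint := (integrable_exp_neg_mul_configEnergy (d := d) (n := m + 1) (b := β / 2) (by positivity)).const_mul
        ((Cψ + 1) * K * (2 * (1 + 2 / β)))
      refine hint.mono' ?_ (Eventually.of_forall fun Y => ?_)
      · exact ((measurable_const.mul (measurable_const.add ((measurable_pi_apply i).snd.norm))).mul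
          ((measurable_const.mul (measurable_configEnergy' (m + 1))).exp)).aestronglyMeasurable
      · rw [Real.norm_eq_abs, abs_of_nonneg (by positivity)]
        have hE := norm_vel_sq_le_two_mul_configEnergy Y i
        have hE0 : 0 ≤ configEnergy Y := configEnergy_nonneg' Y
        -- `(1 + ‖v_i‖) e^{-βE} ≤ (1 + 2/β) e^{-βE/2}` since `‖v_i‖ e^{-βE/2} ≤ 2/β`... we use `‖v_i‖ ≤ 1 + ‖v_i‖²/ 2 ≤ 1 + E`
        have hx : 1 + ‖(Y i).2‖ ≤ 2 * (1 + configEnergy Y) := by nlinarith [norm_nonneg (Y i).2, sq_nonneg (‖(Y i).2‖ - 2)]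
        have hexp : (1 + configEnergy Y) * Real.exp (-β * configEnergy Y) ≤ (1 + 2 / β) * Real.exp (-(β / 2) * configEnergy Y) := by
          have h2 : Real.exp (-β * configEnergy Y) = Real.exp (-(β / 2) * configEnergy Y) * Real.exp (-(β / 2) * configEnergy Y) := by
            rw [← Real.exp_add]; congr 1; ring
          rw [h2, ← mul_assoc]
          refine mul_le_mul_of_nonneg_right ?_ (Real.exp_pos _).le
          -- `(1 + E) e^{-βE/2} ≤ 1 + 2/β`: `E e^{-βE/2} ≤ 2/(eβ) ≤ 2/β` and `e^{-βE/2} ≤ 1`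
          have h3 : Real.exp (-(β / 2) * configEnergy Y) ≤ 1 := by
            rw [Real.exp_le_one_iff]; nlinarith
          have h4 : configEnergy Y * Real.exp (-(β / 2) * configEnergy Y) ≤ 2 / β := by
            have h5 : (β / 2) * configEnergy Y * Real.exp (-(β / 2) * configEnergy Y) ≤ 1 := by
              have := Real.add_one_le_exp ((β / 2) * configEnergy Y)
              have h6 : 0 < Real.exp ((β / 2) * configEnergy Y) := Real.exp_pos _
              rw [show -(β / 2) * configEnergy Y = -((β / 2) * configEnergy Y) by ring, Real.exp_neg]
              rw [mul_inv_le_iff₀ h6]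
              nlinarith
            have hβ2 : 0 < β / 2 := by positivity
            calc configEnergy Y * Real.exp (-(β / 2) * configEnergy Y)
                = ((β / 2) * configEnergy Y * Real.exp (-(β / 2) * configEnergy Y)) / (β / 2) := by
                  field_simp
              _ ≤ 1 / (β / 2) := by gcongr
              _ = 2 / β := by field_simp
          nlinarith [mul_nonneg hE0 (Real.exp_pos (-(β / 2) * configEnergy Y)).le]
        calc (Cψ + 1) * K * (1 + ‖(Y i).2‖) * Real.exp (-β * configEnergy Y)
            ≤ (Cψ + 1) * K * (2 * ((1 + configEnergy Y) * Real.exp (-β * configEnergy Y))) := by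
              rw [mul_assoc ((Cψ + 1) * K)]
              refine mul_le_mul_of_nonneg_left ?_ (by positivity)
              rw [← mul_assoc]
              exact mul_le_mul_of_nonneg_right hx (Real.exp_pos _).le
          _ ≤ (Cψ + 1) * K * (2 * ((1 + 2 / β) * Real.exp (-(β / 2) * configEnergy Y))) :=
              mul_le_mul_of_nonneg_left (mul_le_mul_of_nonneg_left hexp (by norm_num)) (by positivity)
          _ = (Cψ + 1) * K * (2 * (1 + 2 / β)) * Real.exp (-(β / 2) * configEnergy Y) := by ring
    have h2 : Integrable (fun q : sphere (0 : EuclideanSpace ℝ d) 1 × EuclideanSpace ℝ d =>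
        (1 + ‖q.2‖) * Real.exp (-(β / 2) * ‖q.2‖ ^ 2)) κ := by
      have hg := integrable_one_add_norm_mul_exp (E := EuclideanSpace ℝ d) hβ
      have := (integrable_const (μ := sphereMeasure (E := EuclideanSpace ℝ d)) (1 : ℝ)).mul_prod hg
      simpa [hκ] using this
    have := h1.mul_prod h2
    exact this
  -- domination
  have hPloss : ∀ x : Config (m + 1) d (UnitAddTorus d) × (sphere (0 : EuclideanSpace ℝ d) 1 × EuclideanSpace ℝ d),
      |P (lossConfig G ε x.1 i x.2.1 x.2.2)| ≤ K * Real.exp (-β * (configEnergy x.1 + 2⁻¹ * ‖x.2.2‖ ^ 2)) := fun x => by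
    have := hP (lossConfig G ε x.1 i x.2.1 x.2.2)
    rwa [configEnergy_lossConfig] at this
  have hPgain : ∀ x : Config (m + 1) d (UnitAddTorus d) × (sphere (0 : EuclideanSpace ℝ d) 1 × EuclideanSpace ℝ d),
      |P (gainConfig G ε x.1 i x.2.1 x.2.2)| ≤ K * Real.exp (-β * (configEnergy x.1 + 2⁻¹ * ‖x.2.2‖ ^ 2)) := fun x => by
    have := hP (gainConfig G ε x.1 i x.2.1 x.2.2)
    rwa [configEnergy_gainConfig] at this
  have hfluxle : ∀ x : Config (m + 1) d (UnitAddTorus d) × (sphere (0 : EuclideanSpace ℝ d) 1 × EuclideanSpace ℝ d),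
      |⟪(x.2.1 : EuclideanSpace ℝ d), x.2.2 - (x.1 i).2⟫_ℝ| ≤ ‖x.2.2‖ + ‖(x.1 i).2‖ := fun x => by
    have h1 := abs_real_inner_le_norm (x.2.1 : EuclideanSpace ℝ d) (x.2.2 - (x.1 i).2)
    have h2 : ‖(x.2.1 : EuclideanSpace ℝ d)‖ = 1 := by simp
    rw [h2, one_mul] at h1
    exact h1.trans (norm_sub_le _ _)
  have hdom : ∀ (ψv : ℝ) (Pv fl : ℝ) (x : Config (m + 1) d (UnitAddTorus d) × (sphere (0 : EuclideanSpace ℝ d) 1 × EuclideanSpace ℝ d)),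
      |ψv| ≤ Cψ + 1 → |Pv| ≤ K * Real.exp (-β * (configEnergy x.1 + 2⁻¹ * ‖x.2.2‖ ^ 2)) →
      |fl| ≤ ‖x.2.2‖ + ‖(x.1 i).2‖ → |fl * ψv * Pv| ≤ D x := by
    intro ψv Pv fl x h1 h2 h3
    rw [abs_mul, abs_mul, hD]
    simp only
    have hexp : Real.exp (-β * (configEnergy x.1 + 2⁻¹ * ‖x.2.2‖ ^ 2)) =
        Real.exp (-β * configEnergy x.1) * Real.exp (-(β / 2) * ‖x.2.2‖ ^ 2) := by
      rw [← Real.exp_add]; congr 1; ring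
    rw [hexp] at h2
    have h4 : ‖x.2.2‖ + ‖(x.1 i).2‖ ≤ (1 + ‖(x.1 i).2‖) * (1 + ‖x.2.2‖) := by
      nlinarith [norm_nonneg x.2.2, norm_nonneg (x.1 i).2]
    have s1 : |fl| * |ψv| ≤ (‖x.2.2‖ + ‖(x.1 i).2‖) * (Cψ + 1) := mul_le_mul h3 h1 (abs_nonneg _) (by positivity)
    have s2 : |fl| * |ψv| * |Pv| ≤ ((‖x.2.2‖ + ‖(x.1 i).2‖) * (Cψ + 1)) *
        (K * (Real.exp (-β * configEnergy x.1) * Real.exp (-(β / 2) * ‖x.2.2‖ ^ 2))) :=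
      mul_le_mul s1 h2 (abs_nonneg _) (by positivity)
    refine s2.trans ?_
    calc ((‖x.2.2‖ + ‖(x.1 i).2‖) * (Cψ + 1)) * (K * (Real.exp (-β * configEnergy x.1) * Real.exp (-(β / 2) * ‖x.2.2‖ ^ 2)))
        ≤ (((1 + ‖(x.1 i).2‖) * (1 + ‖x.2.2‖)) * (Cψ + 1)) *
          (K * (Real.exp (-β * configEnergy x.1) * Real.exp (-(β / 2) * ‖x.2.2‖ ^ 2))) := by
          gcongr
      _ = _ := by ring
  -- `|max f 0| ≤ |f|`, `|max (-f) 0| ≤ |f|`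
  have hmaxle : ∀ f : ℝ, |max f 0| ≤ |f| := fun f => by
    rw [abs_of_nonneg (le_max_right _ _)]; exact max_le (le_abs_self _) (abs_nonneg _)
  have hmaxle' : ∀ f : ℝ, |max (-f) 0| ≤ |f| := fun f => by
    rw [abs_of_nonneg (le_max_right _ _)]; exact max_le (neg_le_abs _) (abs_nonneg _)
  set μ : Measure (Config (m + 1) d (UnitAddTorus d) × (sphere (0 : EuclideanSpace ℝ d) 1 × EuclideanSpace ℝ d)) :=
    (volume : Measure (Config (m + 1) d (UnitAddTorus d))).prod κ with hμ
  have hai : Integrable a μ := hDi.mono' ham.aestronglyMeasurable (ae_of_all _ fun x => by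
    rw [Real.norm_eq_abs]
    exact hdom _ _ _ x ((hψ _).trans (le_add_of_nonneg_right zero_le_one)) (hPloss x) ((hmaxle _).trans (hfluxle x)))
  have hbi : Integrable b μ := hDi.mono' hbm.aestronglyMeasurable (ae_of_all _ fun x => by
    rw [Real.norm_eq_abs]
    exact hdom _ _ _ x ((hψ _).trans (le_add_of_nonneg_right zero_le_one)) (hPloss x) ((hmaxle _).trans (hfluxle x)))
  have hci : Integrable c μ := hDi.mono' hcm.aestronglyMeasurable (ae_of_all _ fun x => by
    rw [Real.norm_eq_abs]
    exact hdom _ _ _ x ((hψ _).trans (le_add_of_nonneg_right zero_le_one)) (hPgain x) ((hmaxle' _).trans (hfluxle x)))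
  -- sections at a fixed `Y` are integrable on `κ`
  have hDsec : ∀ Y : Config (m + 1) d (UnitAddTorus d), Integrable (fun q => D (Y, q)) κ := by
    intro Y
    have hg := integrable_one_add_norm_mul_exp (E := EuclideanSpace ℝ d) hβ
    have h2 : Integrable (fun q : sphere (0 : EuclideanSpace ℝ d) 1 × EuclideanSpace ℝ d =>
        (1 + ‖q.2‖) * Real.exp (-(β / 2) * ‖q.2‖ ^ 2)) κ := by
      have := (integrable_const (μ := sphereMeasure (E := EuclideanSpace ℝ d)) (1 : ℝ)).mul_prod hg
      simpa [hκ] using this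
    exact (h2.const_mul ((Cψ + 1) * K * (1 + ‖(Y i).2‖) * Real.exp (-β * configEnergy Y))).congr
      (ae_of_all _ fun q => rfl)
  have hasec : ∀ Y, Integrable (fun q => a (Y, q)) κ := fun Y =>
    (hDsec Y).mono' (ham.comp (measurable_const.prodMk measurable_id)).aestronglyMeasurable
      (ae_of_all _ fun q => by
        rw [Real.norm_eq_abs]
        exact hdom _ _ _ (Y, q) ((hψ _).trans (le_add_of_nonneg_right zero_le_one)) (hPloss (Y, q)) ((hmaxle _).trans (hfluxle (Y, q))))
  have hbsec : ∀ Y, Integrable (fun q => b (Y, q)) κ := fun Y =>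
    (hDsec Y).mono' (hbm.comp (measurable_const.prodMk measurable_id)).aestronglyMeasurable
      (ae_of_all _ fun q => by
        rw [Real.norm_eq_abs]
        exact hdom _ _ _ (Y, q) ((hψ _).trans (le_add_of_nonneg_right zero_le_one)) (hPloss (Y, q)) ((hmaxle _).trans (hfluxle (Y, q))))
  have hcsec : ∀ Y, Integrable (fun q => c (Y, q)) κ := fun Y =>
    (hDsec Y).mono' (hcm.comp (measurable_const.prodMk measurable_id)).aestronglyMeasurable
      (ae_of_all _ fun q => by
        rw [Real.norm_eq_abs]
        exact hdom _ _ _ (Y, q) ((hψ _).trans (le_add_of_nonneg_right zero_le_one)) (hPgain (Y, q)) ((hmaxle' _).trans (hfluxle (Y, q))))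
  -- the scattering turns `b` into `c`
  have hbc : ∀ x, b x = c ((fun x : Config (m + 1) d (UnitAddTorus d) × (sphere (0 : EuclideanSpace ℝ d) 1 × EuclideanSpace ℝ d) =>
      ((scatterParams i x.2.1 (x.1, x.2.2)).1, (x.2.1, (scatterParams i x.2.1 (x.1, x.2.2)).2))) x) := by
    intro x
    obtain ⟨Y, ω, v⟩ := x
    simp only [hb, hc]
    have hinv := scatterParams_scatterParams (X := UnitAddTorus d) i ω (Y, v)
    have hflux : -⟪(ω : EuclideanSpace ℝ d), (scatterParams i ω (Y, v)).2 - ((scatterParams i ω (Y, v)).1 i).2⟫_ℝ =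
        ⟪(ω : EuclideanSpace ℝ d), v - (Y i).2⟫_ℝ := by
      rw [real_inner_comm, inner_scatterParams, real_inner_comm, neg_neg]
    have hcfg : gainConfig G ε (scatterParams i ω (Y, v)).1 i ω (scatterParams i ω (Y, v)).2 = lossConfig G ε Y i ω v := by
      rw [gainConfig_eq_lossConfig_scatterParams i ω G ε (scatterParams i ω (Y, v)).1 (scatterParams i ω (Y, v)).2]
      rw [show ((scatterParams i ω (Y, v)).1, (scatterParams i ω (Y, v)).2) = scatterParams i ω (Y, v) from rfl, hinv]
    rw [hflux, hcfg]
  have hΞemb : MeasurableEmbedding (fun x : Config (m + 1) d (UnitAddTorus d) × (sphere (0 : EuclideanSpace ℝ d) 1 × EuclideanSpace ℝ d) =>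
      ((scatterParams i x.2.1 (x.1, x.2.2)).1, (x.2.1, (scatterParams i x.2.1 (x.1, x.2.2)).2))) := by
    let e : (Config (m + 1) d (UnitAddTorus d) × (sphere (0 : EuclideanSpace ℝ d) 1 × EuclideanSpace ℝ d)) ≃ᵐ
        (Config (m + 1) d (UnitAddTorus d) × (sphere (0 : EuclideanSpace ℝ d) 1 × EuclideanSpace ℝ d)) :=
      { toFun := fun x => ((scatterParams i x.2.1 (x.1, x.2.2)).1, (x.2.1, (scatterParams i x.2.1 (x.1, x.2.2)).2))
        invFun := fun x => ((scatterParams i x.2.1 (x.1, x.2.2)).1, (x.2.1, (scatterParams i x.2.1 (x.1, x.2.2)).2))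
        left_inv := scatterSkew_scatterSkew i
        right_inv := scatterSkew_scatterSkew i
        measurable_toFun := hΞ.measurable
        measurable_invFun := hΞ.measurable }
    exact e.measurableEmbedding
  have hIb : ∫ x, b x ∂μ = ∫ x, c x ∂μ := by
    have h := hΞ.integral_comp hΞemb c
    rw [← h]
    exact integral_congr_ae (ae_of_all _ fun x => hbc x)
  -- the three iterated integrals
  have hIa : ∫ x, a x ∂μ = ∫ Y, ψ Y * ∫ q, max ⟪(q.1 : EuclideanSpace ℝ d), q.2 - (Y i).2⟫_ℝ 0 *
      P (lossConfig G ε Y i q.1 q.2) ∂κ := by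
    rw [integral_prod _ hai]
    refine integral_congr_ae (ae_of_all _ fun Y => ?_)
    simp only [ha]
    rw [← integral_const_mul]
    refine integral_congr_ae (ae_of_all _ fun q => ?_)
    simp only
    ring
  have hIc : ∫ x, c x ∂μ = ∫ Y, ψ Y * ∫ q, max (-⟪(q.1 : EuclideanSpace ℝ d), q.2 - (Y i).2⟫_ℝ) 0 *
      P (gainConfig G ε Y i q.1 q.2) ∂κ := by
    rw [integral_prod _ hci]
    refine integral_congr_ae (ae_of_all _ fun Y => ?_)
    simp only [hc]
    rw [← integral_const_mul]
    refine integral_congr_ae (ae_of_all _ fun q => ?_)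
    simp only
    ring
  -- the left-hand side
  have hL : (∫ Y : Config (m + 1) d (UnitAddTorus d), ∫ q, max ⟪(q.1 : EuclideanSpace ℝ d), q.2 - (Y i).2⟫_ℝ 0 *
        (ψ Y - ψ (scatterParams i q.1 (Y, q.2)).1) * P (lossConfig (Torus.geometry d) ε Y i q.1 q.2) ∂κ) =
      ∫ x, a x ∂μ - ∫ x, b x ∂μ := by
    rw [← integral_sub hai hbi, integral_prod (fun x => a x - b x) (hai.sub hbi)]
    refine integral_congr_ae (ae_of_all _ fun Y => ?_)
    refine integral_congr_ae (ae_of_all _ fun q => ?_)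
    simp only [ha, hb, hG]
    ring
  -- the right-hand side
  have hR : (∫ Y : Config (m + 1) d (UnitAddTorus d),
        ψ Y * hsCollisionTerm (Torus.geometry d) ε (m + 1) i (P ∘ outRep (Torus.geometry d) (m + 1) i) Y) =
      ∫ x, a x ∂μ - ∫ x, c x ∂μ := by
    have hinner : ∀ Y : Config (m + 1) d (UnitAddTorus d),
        hsCollisionTerm (Torus.geometry d) ε (m + 1) i (P ∘ outRep (Torus.geometry d) (m + 1) i) Y =
          (∫ q, max ⟪(q.1 : EuclideanSpace ℝ d), q.2 - (Y i).2⟫_ℝ 0 * P (lossConfig G ε Y i q.1 q.2) ∂κ) -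
            ∫ q, max (-⟪(q.1 : EuclideanSpace ℝ d), q.2 - (Y i).2⟫_ℝ) 0 * P (gainConfig G ε Y i q.1 q.2) ∂κ := by
      intro Y
      have ha' : Integrable (fun q : sphere (0 : EuclideanSpace ℝ d) 1 × EuclideanSpace ℝ d =>
          max ⟪(q.1 : EuclideanSpace ℝ d), q.2 - (Y i).2⟫_ℝ 0 * P (lossConfig G ε Y i q.1 q.2)) κ := by
        have h1 := hDsec Y
        refine h1.mono' ?_ (ae_of_all _ fun q => ?_)
        · exact (((hflux.max measurable_const).mul (hPm.comp hloss)).comp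
            (measurable_const.prodMk measurable_id)).aestronglyMeasurable
        · rw [Real.norm_eq_abs]
          have := hdom 1 _ _ (Y, q) (by rw [abs_one]; linarith) (hPloss (Y, q)) ((hmaxle _).trans (hfluxle (Y, q)))
          simpa using this
      have hc' : Integrable (fun q : sphere (0 : EuclideanSpace ℝ d) 1 × EuclideanSpace ℝ d =>
          max (-⟪(q.1 : EuclideanSpace ℝ d), q.2 - (Y i).2⟫_ℝ) 0 * P (gainConfig G ε Y i q.1 q.2)) κ := by
        have h1 := hDsec Y
        refine h1.mono' ?_ (ae_of_all _ fun q => ?_)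
        · exact (((hflux.neg.max measurable_const).mul (hPm.comp hgain)).comp
            (measurable_const.prodMk measurable_id)).aestronglyMeasurable
        · rw [Real.norm_eq_abs]
          have := hdom 1 _ _ (Y, q) (by rw [abs_one]; linarith) (hPgain (Y, q)) ((hmaxle' _).trans (hfluxle (Y, q)))
          simpa using this
      rw [← integral_sub ha' hc', hκ, integral_prod _ (by rw [← hκ]; exact ha'.sub hc')]
      unfold hsCollisionTerm
      refine integral_congr_ae (ae_of_all _ fun ω => ?_)
      refine integral_congr_ae (ae_of_all _ fun v => ?_)
      simp only [Function.comp_apply]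
      rw [outRep_gainConfig_torus hε hε', outRep_lossConfig_torus hε hε']
    have hIa' : Integrable (fun Y : Config (m + 1) d (UnitAddTorus d) =>
        ψ Y * ∫ q, max ⟪(q.1 : EuclideanSpace ℝ d), q.2 - (Y i).2⟫_ℝ 0 * P (lossConfig G ε Y i q.1 q.2) ∂κ) := by
      have h := hai.integral_prod_left
      refine h.congr (ae_of_all _ fun Y => ?_)
      simp only [ha]
      rw [← integral_const_mul]
      refine integral_congr_ae (ae_of_all _ fun q => ?_)
      simp only
      ring
    have hIc' : Integrable (fun Y : Config (m + 1) d (UnitAddTorus d) =>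
        ψ Y * ∫ q, max (-⟪(q.1 : EuclideanSpace ℝ d), q.2 - (Y i).2⟫_ℝ) 0 * P (gainConfig G ε Y i q.1 q.2) ∂κ) := by
      have h := hci.integral_prod_left
      refine h.congr (ae_of_all _ fun Y => ?_)
      simp only [hc]
      rw [← integral_const_mul]
      refine integral_congr_ae (ae_of_all _ fun q => ?_)
      simp only
      ring
    rw [hIa, hIc, ← integral_sub hIa' hIc']
    refine integral_congr_ae (ae_of_all _ fun Y => ?_)
    beta_reduce
    rw [hinner Y]
    ring
  rw [hL, hR, hIb]

end Flux

end Kinetic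

end

end Literature.MathematicalPhysics.KineticTheory
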